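import Mathlib.MeasureTheory.Measure.Haar.Unique
import HarnessLib

/-!
# Transport of Haar measures and of local `∫⁻`-finiteness along a topological isomorphism

Topic `Literature/MeasureTheory/Group`; namespace `Literature.MeasureTheory.Group`.  THEOREMS ONLY (no definition ∕ instance ∕
notation ∕ named fact ∕ `sorry`); Mathlib-only imports.  Cell `pub/hodgecm-mathlib`, crux H413 = `stmt-HodgeConjecture-24833`
(lane `--supports`, count-neutral): brick **(HT) «HAAR TRANSPORT OF LOCAL ∫⁻-FINITENESS ALONG ≃ₜ+»** of the ROAD «HC-D» (holder
F0P2-p01 (g23)), seat LH10-p01 (g7), 2026-09-02.  Consumers: every hand that moves a bound of the shape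
«`∃ U ∈ 𝓝 x, ∫⁻ y in U, f y ∂μ < ∞`» through a coordinate isomorphism (`(CO)`'s `Φ₀`, `Φ_S`, an `Ad g`) or recentres it at `0`.
HONEST LABEL: HC_CM is proved only modulo the 7 printed citations (2 remaining: hLiu418 = `stmt-HodgeConjecture-24832`, h413 =
`stmt-HodgeConjecture-24833`) until rung 0 closes; this file closes no organ.

For a bi-continuous additive isomorphism `e : V ≃ₜ+ W` of topological additive groups (Borel σ-algebras) and additive Haar
measures `μ` on `V`, `ν` on `W` (`W` locally compact second countable, so that Haar measure is unique up to a scalar):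
* `exists_map_eq_smul`: `e_* μ = c • ν` with `0 < c < ∞` (Mathlib: `e_* μ` is a Haar measure; uniqueness);
* `exists_forall_setLIntegral_image_eq_mul`: ONE constant `0 < c < ∞` with `∫⁻_{e A} f dν = c · ∫⁻_A f ∘ e dμ` for ALL `f ≥ 0`
  and ALL sets `A` (no measurability: measurable equivalences need none); preimage twin; hence
  `setLIntegral_image_lt_top_iff` (the neighbourhood forms «local `∫⁻`-finiteness of `f` on `W` ⟺ of `f ∘ e` on `V`» are ★
  `exists_nhds_setLIntegral_lt_top_iff_of_addEquiv` ∕ `forall_…_of_addEquiv` of `LocFiniteLIntegralProductTransfer` §1′ —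
  not restated here);
* bookkeeping: `image_vadd_eq` (`e (v + U) = e v + e U`), and for a left-invariant `μ` the recentring
  `setLIntegral_vadd_set_eq` (`∫⁻_{v+U} f = ∫⁻_U f (v + ·)`) and `exists_nhds_setLIntegral_lt_top_iff_zero`.
No commutativity is assumed.

## References
* [DeitmarEchterhoff2014] A. Deitmar, S. Echterhoff, *Principles of Harmonic Analysis* (2nd ed. 2014), §1.5 (uniqueness of Haar
  measure up to a positive scalar; the modulus of a topological automorphism) — the only input beyond change of variables.
-/

set_option autoImplicit false

noncomputable section

open MeasureTheory MeasureTheory.Measure Set Filter Topology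
open scoped ENNReal Pointwise

namespace Literature.MeasureTheory.Group

/-! ## §1 `e_* μ = c • ν` and the transport of set integrals -/

section Transport

variable {V W : Type*}
  [AddGroup V] [TopologicalSpace V] [IsTopologicalAddGroup V] [MeasurableSpace V] [BorelSpace V]
  [AddGroup W] [TopologicalSpace W] [IsTopologicalAddGroup W] [MeasurableSpace W] [BorelSpace W]
  [LocallyCompactSpace W] [SecondCountableTopology W]
  (e : V ≃ₜ+ W) (μ : Measure V) (ν : Measure W) [μ.IsAddHaarMeasure] [ν.IsAddHaarMeasure]

/-- **`e_* μ = c • ν`, `0 < c < ∞`**: the push-forward of an additive Haar measure along a bi-continuous additive isomorphism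
is a Haar measure (Mathlib instance `ContinuousAddEquiv.isAddHaarMeasure_map`), hence a positive finite multiple of any given
one (`isAddLeftInvariant_eq_smul`). [cite: DeitmarEchterhoff2014, §1.5 (uniqueness of Haar measure up to a positive scalar)] -/
theorem exists_map_eq_smul : ∃ c : ℝ≥0∞, c ≠ 0 ∧ c ≠ ∞ ∧ μ.map e = c • ν := by
  refine ⟨addHaarScalarFactor (μ.map e) ν, ?_, ENNReal.coe_ne_top, isAddLeftInvariant_eq_smul _ _⟩
  simpa only [ne_eq, ENNReal.coe_eq_zero] using (addHaarScalarFactor_pos_of_isAddHaarMeasure (μ.map e) ν).ne'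

/-- Set integrals along a measurable equivalence, image form: `∫⁻_{e A} f d(e_* μ) = ∫⁻_A f ∘ e dμ` (any `f`, any `A`).
[folklore] -/
private theorem setLIntegral_image_map_equiv {α β : Type*} [MeasurableSpace α] [MeasurableSpace β] (m : Measure α)
    (g : α ≃ᵐ β) (f : β → ℝ≥0∞) (A : Set α) : ∫⁻ w in g '' A, f w ∂(m.map g) = ∫⁻ v in A, f (g v) ∂m := by
  rw [MeasurableEquiv.restrict_map, lintegral_map_equiv, g.injective.preimage_image]

/-- **Transport of set integrals, image form.**  There is ONE constant `0 < c < ∞` (namely `ν = c • e_* μ`) with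
`∫⁻ w in e '' A, f w ∂ν = c * ∫⁻ v in A, f (e v) ∂μ` for every `f : W → ℝ≥0∞` and every set `A ⊆ V` — no measurability of
`f` or `A` required. [cite: DeitmarEchterhoff2014, §1.5 (uniqueness of Haar measure up to a positive scalar)] -/
theorem exists_forall_setLIntegral_image_eq_mul :
    ∃ c : ℝ≥0∞, c ≠ 0 ∧ c ≠ ∞ ∧ ∀ (f : W → ℝ≥0∞) (A : Set V), ∫⁻ w in e '' A, f w ∂ν = c * ∫⁻ v in A, f (e v) ∂μ := by
  obtain ⟨c, hc0, hct, hmap⟩ := exists_map_eq_smul e μ ν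
  let em : V ≃ᵐ W := e.toHomeomorph.toMeasurableEquiv
  have hem : μ.map em = μ.map e := rfl
  have hν : ν = c⁻¹ • μ.map em := by
    rw [hem, hmap, smul_smul, ENNReal.inv_mul_cancel hc0 hct, one_smul]
  refine ⟨c⁻¹, ENNReal.inv_ne_zero.2 hct, ENNReal.inv_ne_top.2 hc0, fun f A => ?_⟩
  rw [hν, Measure.restrict_smul, lintegral_smul_measure, smul_eq_mul]
  exact congrArg (c⁻¹ * ·) (setLIntegral_image_map_equiv μ em f A)

/-- **Transport of set integrals, preimage form**: ONE constant `0 < c < ∞` with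
`∫⁻ v in e ⁻¹' B, f (e v) ∂μ = c * ∫⁻ w in B, f w ∂ν` for all `f` and all `B ⊆ W`.
[cite: DeitmarEchterhoff2014, §1.5 (uniqueness of Haar measure up to a positive scalar)] -/
theorem exists_forall_setLIntegral_preimage_eq_mul :
    ∃ c : ℝ≥0∞, c ≠ 0 ∧ c ≠ ∞ ∧ ∀ (f : W → ℝ≥0∞) (B : Set W), ∫⁻ v in e ⁻¹' B, f (e v) ∂μ = c * ∫⁻ w in B, f w ∂ν := by
  obtain ⟨c, hc0, hct, h⟩ := exists_forall_setLIntegral_image_eq_mul e μ ν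
  refine ⟨c⁻¹, ENNReal.inv_ne_zero.2 hct, ENNReal.inv_ne_top.2 hc0, fun f B => ?_⟩
  rw [← e.surjective.image_preimage B, h f (e ⁻¹' B), e.surjective.image_preimage, ← mul_assoc,
    ENNReal.inv_mul_cancel hc0 hct, one_mul]

/-- **`∫⁻_{e A} f dν < ∞ ↔ ∫⁻_A f ∘ e dμ < ∞`** for Haar measures `μ`, `ν` and a bi-continuous additive isomorphism `e`
(any `f`, any `A`). [cite: DeitmarEchterhoff2014, §1.5 (uniqueness of Haar measure up to a positive scalar)] -/
theorem setLIntegral_image_lt_top_iff (f : W → ℝ≥0∞) (A : Set V) :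
    ∫⁻ w in e '' A, f w ∂ν < ∞ ↔ ∫⁻ v in A, f (e v) ∂μ < ∞ := by
  obtain ⟨c, hc0, hct, h⟩ := exists_forall_setLIntegral_image_eq_mul e μ ν
  rw [h f A]
  constructor
  · intro hlt
    by_contra hinf
    rw [not_lt, top_le_iff] at hinf
    rw [hinf, ENNReal.mul_top hc0] at hlt
    exact lt_irrefl _ hlt
  · intro hlt
    exact ENNReal.mul_lt_top hct.lt_top hlt

/- The neighbourhood forms «`f` locally `∫⁻`-finite at `e v` (w.r.t. `ν`) ⟺ `f ∘ e` at `v` (w.r.t. `μ`)» are ★ already: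
`Literature.MeasureTheory.Group.exists_nhds_setLIntegral_lt_top_iff_of_addEquiv` ∕ `forall_…_iff_of_addEquiv`
(`LocFiniteLIntegralProductTransfer` §1′, F0P3a-p07) — cited by name, not restated. -/

end Transport

/-! ## §2 Bookkeeping: translates -/

section Translate

variable {V W : Type*} [AddGroup V] [TopologicalSpace V] [AddGroup W] [TopologicalSpace W]

omit [TopologicalSpace V] [TopologicalSpace W] in
/-- **`e (v + U) = e v + e U`** for an additive isomorphism and a translate `v +ᵥ U`. [folklore] -/
private theorem image_vadd_eq_aux (e : V ≃+ W) (v : V) (U : Set V) : e '' (v +ᵥ U) = e v +ᵥ e '' U := by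
  rw [← image_vadd, ← image_vadd, image_image, image_image]
  exact image_congr fun x _ => map_add e v x

/-- **`e (v + U) = e v + e U`** for a bi-continuous additive isomorphism `e` (the translate bookkeeping consumers of
★ `exists_nhds_setLIntegral_lt_top_iff_of_addEquiv` need). [cite: DeitmarEchterhoff2014, §1.5 (modulus of a topological automorphism)] -/
theorem image_vadd_eq (e : V ≃ₜ+ W) (v : V) (U : Set V) : e '' (v +ᵥ U) = e v +ᵥ e '' U :=
  image_vadd_eq_aux e.toAddEquiv v U

variable [IsTopologicalAddGroup V] [MeasurableSpace V] [BorelSpace V] (μ : Measure V) [μ.IsAddLeftInvariant]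

/-- **Recentring a set integral**: `∫⁻ x in v +ᵥ U, f x ∂μ = ∫⁻ x in U, f (v + x) ∂μ` for a LEFT-INVARIANT Borel measure
`μ` (any `f`, any `U`). [cite: DeitmarEchterhoff2014, §1.5 (left invariance of Haar measure)] -/
theorem setLIntegral_vadd_set_eq (v : V) (U : Set V) (f : V → ℝ≥0∞) :
    ∫⁻ x in v +ᵥ U, f x ∂μ = ∫⁻ x in U, f (v + x) ∂μ := by
  let T : V ≃ᵐ V := (Homeomorph.addLeft v).toMeasurableEquiv
  have hT : ∀ x, T x = v + x := fun _ => rfl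
  have hmap : μ.map T = μ := map_add_left_eq_self μ v
  have hU : v +ᵥ U = T '' U := by
    rw [← image_vadd]
    exact image_congr fun x _ => (hT x).symm
  calc ∫⁻ x in v +ᵥ U, f x ∂μ = ∫⁻ x in T '' U, f x ∂(μ.map T) := by rw [hmap, hU]
    _ = ∫⁻ x in U, f (T x) ∂μ := by rw [MeasurableEquiv.restrict_map, lintegral_map_equiv, T.injective.preimage_image]
    _ = ∫⁻ x in U, f (v + x) ∂μ := rfl

/-- **Local `∫⁻`-finiteness at `v` ⟺ at `0` for the recentred function** `x ↦ f (v + x)` (left-invariant `μ`).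
[cite: DeitmarEchterhoff2014, §1.5 (left invariance of Haar measure)] -/
theorem exists_nhds_setLIntegral_lt_top_iff_zero (v : V) (f : V → ℝ≥0∞) :
    (∃ U ∈ 𝓝 v, ∫⁻ x in U, f x ∂μ < ∞) ↔ ∃ U ∈ 𝓝 (0 : V), ∫⁻ x in U, f (v + x) ∂μ < ∞ := by
  constructor
  · rintro ⟨U, hU, hfin⟩
    refine ⟨-v +ᵥ U, ?_, ?_⟩
    · have h := (Homeomorph.addLeft (-v)).isOpenMap.image_mem_nhds hU
      simp only [Homeomorph.coe_addLeft, neg_add_cancel] at h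
      rw [← image_vadd]
      exact h
    · rw [← setLIntegral_vadd_set_eq μ v, vadd_vadd, add_neg_cancel, zero_vadd]
      exact hfin
  · rintro ⟨U, hU, hfin⟩
    refine ⟨v +ᵥ U, ?_, ?_⟩
    · have h := (Homeomorph.addLeft v).isOpenMap.image_mem_nhds hU
      simp only [Homeomorph.coe_addLeft, add_zero] at h
      rw [← image_vadd]
      exact h
    · rw [setLIntegral_vadd_set_eq μ v]
      exact hfin

end Translate

end Literature.MeasureTheory.Group

end
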